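import Literature.NumberTheory.ComplexMultiplication.CMTypeRankFamilies
import HarnessLib

/-!
# Reduction of a family of types on TRANSITIVE slots to a family of types of the group acting on itself

Companion of `NumberTheory/ComplexMultiplication/CMTypeRankFamilies` (the family type `Σ = sigmaType Φ ⊆ ⊔_i E_i` of a
family `Φ_i ⊆ E_i`, a group `G` acting slot by slot; `typeRank G Σ` = the rank of the span of the translates).  When `G`
acts TRANSITIVELY on every slot (for Galois groups: `E_i = Hom(K_i, ℂ)` is one orbit, Shimura §8.1), a choice of base
points `x_i ∈ E_i` pulls the family back along the orbit maps `g ↦ g·x_i` to the family `Ψ_i = {g | g·x_i ∈ Φ_i}` of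
types of `G` acting on ITSELF by translation (Kubota's setting "`(F; {σᵢ})` … `G` the Galois group of `F/ℚ`", where
the `σᵢ` are read as elements of `G`):

* `translateInd_sigmaType_pullback`, `translateInd_one_pullback` — the dictionary `[h·(i,g) ∈ ⊔Ψ] = [h·(i, g·x_i) ∈ Σ]`,
  `[g ∈ Ψ_i] = [g·x_i ∈ Φ_i]`;
* **`typeRank_sigmaType_eq_typeRank_pullback`** — `rank(Σ) = rank(⊔_i Ψ_i)`: precomposition with the (surjective) orbit
  maps is an injective linear map `ℚ^{⊔E_i} → ℚ^{⊔G}` carrying translates to translates.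

Used by `CMTypeRankCharactersFamilies` (Kubota's Lemma 2 for families).  Theorems only; no definition, no named fact,
no `sorry`.

## Sources

* [Kubota1965] T. Kubota, *On the field extension by complex multiplication*, Trans. AMS 118 (1965), §2 (p. 115), §4.
* [Shimura1998] G. Shimura, *Abelian Varieties with Complex Multiplication and Modular Functions*, §8.1.
-/

set_option autoImplicit false

noncomputable section

namespace Literature.NumberTheory.ComplexMultiplication

/-! ### Reduction to free slots -/

section Pullback

variable {G : Type*} [Group G] {I : Type*} {E : I → Type*} [∀ i, MulAction G (E i)]

/-- The pulled-back family `Ψ_i = {g | g·x_i ∈ Φ_i}` of types of `G` (acting on itself) has the translates of `Σ`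
read through the orbit maps: `[h·(i,g) ∈ ⊔Ψ] = [h·(i, g·x_i) ∈ Σ]`. [cite: Kubota1965, §2 (p. 115)] -/
theorem translateInd_sigmaType_pullback (Φ : ∀ i, Set (E i)) (x : ∀ i, E i) (h : G) (i : I) (g : G) :
    translateInd (sigmaType fun i => {g : G | g • x i ∈ Φ i}) h (⟨i, g⟩ : Σ _ : I, G) =
      translateInd (sigmaType Φ) h ⟨i, g • x i⟩ := by
  rw [translateInd_sigmaType, translateInd_sigmaType]
  by_cases hm : h • g • x i ∈ Φ i
  · rw [translateInd_of_mem hm, translateInd_of_mem]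
    show (h • g) • x i ∈ Φ i
    rwa [smul_eq_mul, mul_smul]
  · rw [translateInd_of_not_mem hm, translateInd_of_not_mem]
    show ¬(h • g) • x i ∈ Φ i
    rwa [smul_eq_mul, mul_smul]

/-- `[g·x_i ∈ Φ_i] = [1·g ∈ Ψ_i]`: the pulled-back type read at `g`. [cite: Kubota1965, §2 (p. 115)] -/
theorem translateInd_one_pullback (Φ : ∀ i, Set (E i)) (x : ∀ i, E i) (i : I) (g : G) :
    translateInd ({g : G | g • x i ∈ Φ i}) (1 : G) g = translateInd (Φ i) g (x i) := by
  by_cases hm : g • x i ∈ Φ i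
  · rw [translateInd_of_mem hm, translateInd_of_mem]
    show (1 : G) • g ∈ {g : G | g • x i ∈ Φ i}
    rwa [one_smul]
  · rw [translateInd_of_not_mem hm, translateInd_of_not_mem]
    show ¬(1 : G) • g ∈ {g : G | g • x i ∈ Φ i}
    rwa [one_smul]

/-- **Reduction to free slots.**  For TRANSITIVE slots the pull-back along the orbit maps `g ↦ g·x_i` is an injective
linear map carrying the translates of `Σ` onto the translates of `⊔_i Ψ_i`; hence `rank(Σ) = rank(⊔_i Ψ_i)`.
[cite: Kubota1965, §2 (p. 115)] -/
theorem typeRank_sigmaType_eq_typeRank_pullback [∀ i, MulAction.IsPretransitive G (E i)] (Φ : ∀ i, Set (E i))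
    (x : ∀ i, E i) : typeRank G (sigmaType Φ) = typeRank G (sigmaType fun i => {g : G | g • x i ∈ Φ i}) := by
  let P : ((Σ i, E i) → ℚ) →ₗ[ℚ] ((Σ _ : I, G) → ℚ) :=
    { toFun := fun f y => f ⟨y.1, y.2 • x y.1⟩
      map_add' := fun _ _ => rfl
      map_smul' := fun _ _ => rfl }
  have hPapp : ∀ (f : (Σ i, E i) → ℚ) (y : Σ _ : I, G), P f y = f ⟨y.1, y.2 • x y.1⟩ := fun _ _ => rfl
  have hPinj : Function.Injective P := by
    intro f f' hff'
    funext y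
    obtain ⟨i, s⟩ := y
    obtain ⟨g, hg⟩ := MulAction.exists_smul_eq G (x i) s
    have := congrFun hff' ⟨i, g⟩
    rw [hPapp, hPapp] at this
    simpa only [hg] using this
  have hP : ∀ h : G, P (translateInd (sigmaType Φ) h) = translateInd (sigmaType fun i => {g : G | g • x i ∈ Φ i}) h := by
    intro h
    funext y
    obtain ⟨i, g⟩ := y
    rw [hPapp]
    exact (translateInd_sigmaType_pullback Φ x h i g).symm
  have hrange : Set.range (fun h : G => translateInd (sigmaType fun i => {g : G | g • x i ∈ Φ i}) h) =
      P '' Set.range (fun h : G => translateInd (sigmaType Φ) h) := by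
    rw [← Set.range_comp]
    exact congrArg Set.range (funext fun h => (hP h).symm)
  unfold typeRank
  rw [hrange, ← Submodule.map_span]
  exact LinearEquiv.finrank_eq (Submodule.equivMapOfInjective P hPinj
    (Submodule.span ℚ (Set.range fun h : G => translateInd (sigmaType Φ) h)))

end Pullback

end Literature.NumberTheory.ComplexMultiplication

end
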